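import Summits.Ventures.DiscreteObjects.Hadamard.Order6NegaCore

/-!
# Tools for the type-I case of the order-6 theorem: signed permutation matrices, block algebra, 6×6 identities

Framing: lottery ticket; floor = certified bounds/negative ranges.

Cell pub-namedobj (venture DiscreteObjects), target (H), hadamard gen 14.  Generic lemmas used by `Order6TypeICore`:
* `signedPermMatrix_pow` — `(Q^m) k i = [k = τ^m i]·∏_{j<m} dC (τ^j i)` for the signed permutation matrix `Q k i = [k = τ i]·dC i`;
  `signedPermMatrix_mul_transpose` / `signedPermMatrix_transpose_mul` (orthogonality);
* `poly6_typeI_identity` — the one-variable identity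
  `((Q+Q⁵)² − 4)((Q+Q⁵) + 1) = (Q⁹ + 3Q⁵ + Q⁴ + Q³ + 3Q + 2)(Q⁶ − 1) − (Q − 2)(Q⁴ + Q³ − Q − 1)` (any ring; `noncomm_ring`), and
  `typeI_poly_vanish`: `Q Qᵀ = 1`, `Q⁶ = 1`, `Q⁴ + Q³ − Q − 1 = 0` ⇒ `((Q + Qᵀ)² − 4)(Q + Qᵀ + 1) = 0`;
* block algebra on `(Fin 6 × A) ⊕ C` (`six_blocks_transpose_add`, `six_blocks_cubic`, `six_blocks_fold`), `cubic_intertwine`,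
  `smul_intertwine`;
* the explicit 6×6 identities for the plain 6-cycle: `cyc6_add_transpose`, `cyc6sym_sq`, `cyc6sym_cubic`
  (`(S₆² − 4)(S₆ + 1)` explicitly) and the folding rows `U₀ = [[√3, √3, 0, −√3, −√3, 0], [−1, 1, 2, 1, −1, −2]]` over `ℚ(√3)`:
  `fold6one_mul_transpose` (`U₀ U₀ᵀ = 12·1`), `fold6one_transpose_mul` (`U₀ᵀ U₀ = −2 (S₆² − 4)(S₆ + 1)`).
Elementary; ours; no `sorry`.
-/

namespace Summit.Ventures.DiscreteObjects.Hadamard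

open Finset BigOperators Matrix QuadraticAlgebra

open Literature.Combinatorics.Designs.GoethalsSeidel (IsHadamardMatrix)

section signedPermMatrix
variable {C : Type*} [Fintype C] [DecidableEq C] {F : Type*} [CommRing F]

/-- **Powers of a signed permutation matrix**: for `Q k i = [k = τ i]·dC i`,
`(Q^m) k i = [k = τ^m i] · ∏_{j<m} dC (τ^j i)`. -/
theorem signedPermMatrix_pow (τ : Equiv.Perm C) (dC : C → F) (Q : Matrix C C F)
    (hQ : Q = fun k i => if k = τ i then dC i else 0) (m : ℕ) :
    Q ^ m = fun k i => if k = (τ ^ m) i then ∏ j ∈ range m, dC ((τ ^ j) i) else 0 := by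
  induction m with
  | zero =>
    ext k i
    rw [pow_zero, Matrix.one_apply]
    simp only [pow_zero, Equiv.Perm.one_apply, Finset.range_zero, Finset.prod_empty]
  | succ m ih =>
    ext k i
    rw [pow_succ, Matrix.mul_apply, Finset.sum_eq_single (τ i)]
    · rw [ih, hQ]
      simp only [if_true]
      have e1 : (τ ^ m) (τ i) = (τ ^ (m + 1)) i := by rw [pow_succ, Equiv.Perm.mul_apply]
      have e2 : (∏ j ∈ range m, dC ((τ ^ j) (τ i))) * dC i = ∏ j ∈ range (m + 1), dC ((τ ^ j) i) := by
        rw [Finset.prod_range_succ']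
        simp [pow_succ, Equiv.Perm.mul_apply]
      rw [e1]
      split_ifs with h
      · exact e2
      · exact zero_mul _
    · intro l _ hl
      rw [hQ]
      simp [hl]
    · intro h; exact absurd (Finset.mem_univ _) h

/-- a signed permutation matrix is orthogonal: `Q Qᵀ = 1` -/
theorem signedPermMatrix_mul_transpose (τ : Equiv.Perm C) (dC : C → F) (Q : Matrix C C F)
    (hQ : Q = fun k i => if k = τ i then dC i else 0) (hd : ∀ i, dC i * dC i = 1) : Q * Qᵀ = 1 := by
  ext k l
  rw [Matrix.mul_apply, Finset.sum_eq_single (τ.symm k), Matrix.one_apply]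
  · rw [transpose_apply, hQ]
    simp only [Equiv.apply_symm_apply, if_true]
    by_cases hkl : k = l
    · subst hkl; simp [hd]
    · have hlk : ¬ (l = k) := fun h => hkl h.symm
      simp [hkl, hlk]
  · intro i _ hi
    rw [transpose_apply, hQ]
    have : k ≠ τ i := fun h => hi (by rw [h, Equiv.symm_apply_apply])
    simp [this]
  · intro h; exact absurd (Finset.mem_univ _) h

/-- a signed permutation matrix is orthogonal: `Qᵀ Q = 1` -/
theorem signedPermMatrix_transpose_mul (τ : Equiv.Perm C) (dC : C → F) (Q : Matrix C C F)
    (hQ : Q = fun k i => if k = τ i then dC i else 0) (hd : ∀ i, dC i * dC i = 1) : Qᵀ * Q = 1 := by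
  ext i j
  rw [Matrix.mul_apply, Finset.sum_eq_single (τ i), Matrix.one_apply]
  · rw [transpose_apply, hQ]
    simp only [if_true]
    by_cases hij : i = j
    · subst hij; simp [hd]
    · have : ¬ (τ i = τ j) := fun h => hij (τ.injective h)
      simp [this, hij]
  · intro k _ hk
    rw [transpose_apply, hQ]
    simp [hk]
  · intro h; exact absurd (Finset.mem_univ _) h

/-- the one-variable polynomial identity behind the vanishing of `(S² − 4)(S + 1)`, `S = Q + Q⁵`, modulo `Q⁶ − 1` and
`Q⁴ + Q³ − Q − 1` -/
theorem poly6_typeI_identity {R : Type*} [Ring R] (Q : R) :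
    ((Q + Q ^ 5) * (Q + Q ^ 5) - 4) * ((Q + Q ^ 5) + 1) =
      (Q ^ 9 + 3 * Q ^ 5 + Q ^ 4 + Q ^ 3 + 3 * Q + 2) * (Q ^ 6 - 1) - (Q - 2) * (Q ^ 4 + Q ^ 3 - Q - 1) := by
  have h4 : (4 : R) = 2 * 2 := by norm_num
  rw [h4]
  noncomm_ring

/-- **Vanishing of `(S² − 4)(S + 1)` on the non-6-cycle part**: if `Q Qᵀ = 1`, `Q⁶ = 1` and `Q⁴ + Q³ − Q − 1 = 0`, then
`S = Q + Qᵀ` satisfies `(S² − 4·1)(S + 1) = 0`. -/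
theorem typeI_poly_vanish (Q : Matrix C C F) (hQQt : Q * Qᵀ = 1) (hQ6 : Q ^ 6 = 1)
    (hrel : Q ^ 4 + Q ^ 3 - Q - 1 = 0) :
    ((Q + Qᵀ) * (Q + Qᵀ) + (-4 : F) • (1 : Matrix C C F)) * ((Q + Qᵀ) + 1) = 0 := by
  have hQt : Qᵀ = Q ^ 5 := by
    calc Qᵀ = Q ^ 6 * Qᵀ := by rw [hQ6, Matrix.one_mul]
      _ = Q ^ 5 * (Q * Qᵀ) := by rw [pow_succ, Matrix.mul_assoc]
      _ = Q ^ 5 := by rw [hQQt, Matrix.mul_one]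
  have h4 : (-4 : F) • (1 : Matrix C C F) = -4 := by
    rw [neg_smul, Matrix.smul_one_eq_diagonal, Matrix.diagonal_ofNat]
  rw [hQt, h4, ← sub_eq_add_neg, poly6_typeI_identity, hQ6, hrel, sub_self, Matrix.mul_zero, Matrix.mul_zero,
    sub_zero]

end signedPermMatrix

section blocks6C
variable {A C : Type*} {F : Type*} [CommRing F]

/-- block algebra: `P + Pᵀ` for `P = diag(N₆, …) ⊕ Q` -/
lemma six_blocks_transpose_add [DecidableEq A] (N₆ : Matrix (Fin 6) (Fin 6) F) (Q : Matrix C C F)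
    (P : Matrix ((Fin 6 × A) ⊕ C) ((Fin 6 × A) ⊕ C) F)
    (hP : P = Matrix.fromBlocks (blockDiagonal (fun _ : A => N₆)) 0 0 Q) :
    P + Pᵀ = Matrix.fromBlocks (blockDiagonal (fun _ : A => N₆ + N₆ᵀ)) 0 0 (Q + Qᵀ) := by
  rw [hP, fromBlocks_transpose, fromBlocks_add, transpose_zero, transpose_zero, add_zero, add_zero,
    blockDiagonal_transpose, ← blockDiagonal_add]
  rfl

/-- block algebra: the cubic `(S² − c·1)(S + 1)` of `S = diag(S₆, …) ⊕ S_C` is computed blockwise -/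
lemma six_blocks_cubic [Fintype A] [DecidableEq A] [Fintype C] [DecidableEq C] (S₆ : Matrix (Fin 6) (Fin 6) F)
    (SC : Matrix C C F) (c : F)
    (S : Matrix ((Fin 6 × A) ⊕ C) ((Fin 6 × A) ⊕ C) F)
    (hS : S = Matrix.fromBlocks (blockDiagonal (fun _ : A => S₆)) 0 0 SC) :
    (S * S + c • (1 : Matrix _ _ F)) * (S + 1) =
      Matrix.fromBlocks (blockDiagonal (fun _ : A => (S₆ * S₆ + c • (1 : Matrix _ _ F)) * (S₆ + 1))) 0 0
        ((SC * SC + c • (1 : Matrix _ _ F)) * (SC + 1)) := by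
  classical
  have hSS : S * S = Matrix.fromBlocks (blockDiagonal (fun _ : A => S₆ * S₆)) 0 0 (SC * SC) := by
    rw [hS, fromBlocks_multiply]
    simp only [Matrix.mul_zero, Matrix.zero_mul, add_zero, zero_add]
    rw [← blockDiagonal_mul]
  have h1' : blockDiagonal (fun _ : A => (1 : Matrix (Fin 6) (Fin 6) F)) = 1 := blockDiagonal_one
  have h1 : (1 : Matrix ((Fin 6 × A) ⊕ C) ((Fin 6 × A) ⊕ C) F) =
      Matrix.fromBlocks (blockDiagonal (fun _ : A => (1 : Matrix (Fin 6) (Fin 6) F))) 0 0 1 := by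
    rw [h1', fromBlocks_one]
  rw [hSS, hS, h1, fromBlocks_smul, fromBlocks_add, fromBlocks_add, fromBlocks_multiply]
  simp only [smul_zero, add_zero, Matrix.mul_zero, Matrix.zero_mul, zero_add]
  rw [← blockDiagonal_smul, ← blockDiagonal_add, ← blockDiagonal_add, ← blockDiagonal_mul]
  rfl

/-- block algebra: the Gram matrices of the folding matrix `U = (diag(U₀, …) | 0)` on `(Fin 6 × A) ⊕ C` -/
lemma six_blocks_fold [Fintype A] [DecidableEq A] [Fintype C] (U₀ : Matrix (Fin 2) (Fin 6) F)
    (R₀ : Matrix (Fin 6) (Fin 6) F) (s : F)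
    (hA2 : U₀ᵀ * U₀ = R₀) (hA1 : U₀ * U₀ᵀ = s • 1)
    (U : Matrix (Fin 2 × A) ((Fin 6 × A) ⊕ C) F) (hU : U = Matrix.fromCols (blockDiagonal (fun _ : A => U₀)) 0) :
    Uᵀ * U = Matrix.fromBlocks (blockDiagonal (fun _ : A => R₀)) 0 0 0 ∧ U * Uᵀ = s • 1 := by
  constructor
  · rw [hU, transpose_fromCols, fromRows_mul_fromCols, transpose_zero, Matrix.mul_zero, Matrix.zero_mul,
      Matrix.zero_mul, blockDiagonal_transpose, ← blockDiagonal_mul]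
    rw [show (fun _ : A => U₀ᵀ * U₀) = fun _ => R₀ from funext fun _ => hA2]
  · rw [hU, transpose_fromCols, fromCols_mul_fromRows, transpose_zero, Matrix.mul_zero, add_zero,
      blockDiagonal_transpose, ← blockDiagonal_mul]
    have e1 : (fun _ : A => U₀ * U₀ᵀ) = s • (1 : A → Matrix (Fin 2) (Fin 2) F) := by
      funext c; rw [hA1]; rfl
    rw [e1, blockDiagonal_smul, blockDiagonal_one]

/-- polynomial intertwining: `H X = Y H` implies `H (X² + c)(X + 1) = (Y² + c)(Y + 1) H` -/
lemma cubic_intertwine {ι : Type*} [Fintype ι] [DecidableEq ι] (Hq X Y : Matrix ι ι F) (c : F) (hXY : Hq * X = Y * Hq) :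
    Hq * ((X * X + c • (1 : Matrix ι ι F)) * (X + 1)) = ((Y * Y + c • (1 : Matrix ι ι F)) * (Y + 1)) * Hq := by
  have h2 : Hq * (X * X) = Y * Y * Hq := by
    rw [← Matrix.mul_assoc, hXY, Matrix.mul_assoc, hXY, Matrix.mul_assoc]
  have h3 : Hq * (X * X * X) = Y * Y * Y * Hq := by
    rw [← Matrix.mul_assoc Hq (X * X) X, h2, Matrix.mul_assoc (Y * Y) Hq X, hXY, ← Matrix.mul_assoc]
  have eL : (X * X + c • (1 : Matrix ι ι F)) * (X + 1) = X * X * X + X * X + c • X + c • (1 : Matrix ι ι F) := by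
    rw [Matrix.add_mul, Matrix.mul_add, Matrix.mul_one, Matrix.smul_mul, Matrix.one_mul, smul_add]
    abel
  have eR : (Y * Y + c • (1 : Matrix ι ι F)) * (Y + 1) = Y * Y * Y + Y * Y + c • Y + c • (1 : Matrix ι ι F) := by
    rw [Matrix.add_mul, Matrix.mul_add, Matrix.mul_one, Matrix.smul_mul, Matrix.one_mul, smul_add]
    abel
  rw [eL, eR]
  simp only [Matrix.mul_add, Matrix.add_mul, Matrix.mul_smul, Matrix.smul_mul, Matrix.mul_one, Matrix.one_mul,
    h3, h2, hXY]

/-- scalar intertwining: `H X = Y H` implies `H (a • X) = (a • Y) H` -/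
lemma smul_intertwine {ι : Type*} [Fintype ι] (Hq X Y : Matrix ι ι F) (a : F) (hXY : Hq * X = Y * Hq) :
    Hq * (a • X) = (a • Y) * Hq := by
  rw [Matrix.mul_smul, Matrix.smul_mul, hXY]

end blocks6C

section finite6
/-- the plain `6`-cycle block plus its transpose is the explicit symmetric `0/1` matrix `S₆` -/
lemma cyc6_add_transpose {F : Type*} [Ring F] (N₆ : Matrix (Fin 6) (Fin 6) F)
    (hN : N₆ = fun k i => if k = i + 1 then 1 else 0) :
    N₆ + N₆ᵀ =
      !![0, 1, 0, 0, 0, 1; 1, 0, 1, 0, 0, 0; 0, 1, 0, 1, 0, 0; 0, 0, 1, 0, 1, 0; 0, 0, 0, 1, 0, 1; 1, 0, 0, 0, 1, 0] := by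
  ext i j : 1
  fin_cases i <;> fin_cases j <;> simp [hN, Matrix.add_apply]

/-- the square of the plain `S₆` -/
lemma cyc6sym_sq {F : Type*} [CommRing F] :
    (!![0, 1, 0, 0, 0, 1; 1, 0, 1, 0, 0, 0; 0, 1, 0, 1, 0, 0; 0, 0, 1, 0, 1, 0; 0, 0, 0, 1, 0, 1; 1, 0, 0, 0, 1, 0] :
        Matrix (Fin 6) (Fin 6) F) *
      !![0, 1, 0, 0, 0, 1; 1, 0, 1, 0, 0, 0; 0, 1, 0, 1, 0, 0; 0, 0, 1, 0, 1, 0; 0, 0, 0, 1, 0, 1; 1, 0, 0, 0, 1, 0] =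
      !![2, 0, 1, 0, 1, 0; 0, 2, 0, 1, 0, 1; 1, 0, 2, 0, 1, 0; 0, 1, 0, 2, 0, 1; 1, 0, 1, 0, 2, 0; 0, 1, 0, 1, 0, 2] := by
  ext i j : 1
  fin_cases i <;> fin_cases j <;> simp [Matrix.mul_apply, Fin.sum_univ_six] <;> norm_num

/-- the cubic `(S₆² − 4·1)(S₆ + 1)` of the plain `S₆`, explicitly -/
lemma cyc6sym_cubic {F : Type*} [CommRing F] :
    ((!![2, 0, 1, 0, 1, 0; 0, 2, 0, 1, 0, 1; 1, 0, 2, 0, 1, 0; 0, 1, 0, 2, 0, 1; 1, 0, 1, 0, 2, 0; 0, 1, 0, 1, 0, 2] :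
        Matrix (Fin 6) (Fin 6) F) + (-4 : F) • (1 : Matrix (Fin 6) (Fin 6) F)) *
      ((!![0, 1, 0, 0, 0, 1; 1, 0, 1, 0, 0, 0; 0, 1, 0, 1, 0, 0; 0, 0, 1, 0, 1, 0; 0, 0, 0, 1, 0, 1; 1, 0, 0, 0, 1, 0] :
        Matrix (Fin 6) (Fin 6) F) + 1) =
      !![-2, -1, 1, 2, 1, -1; -1, -2, -1, 1, 2, 1; 1, -1, -2, -1, 1, 2; 2, 1, -1, -2, -1, 1; 1, 2, 1, -1, -2, -1;
        -1, 1, 2, 1, -1, -2] := by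
  ext i j : 1
  fin_cases i <;> fin_cases j <;>
    simp [Matrix.mul_apply, Fin.sum_univ_six, Matrix.add_apply, Matrix.one_apply] <;> norm_num

/-- the folding rows `U₀` for the eigenvalue `1` of the plain `S₆` over `ℚ(√3)`: `U₀ U₀ᵀ = 12·1` -/
lemma fold6one_mul_transpose :
    (!![ω, ω, 0, -ω, -ω, 0; -1, 1, 2, 1, -1, -2] : Matrix (Fin 2) (Fin 6) (QuadraticAlgebra ℚ 3 0)) *
      (!![ω, ω, 0, -ω, -ω, 0; -1, 1, 2, 1, -1, -2] : Matrix (Fin 2) (Fin 6) (QuadraticAlgebra ℚ 3 0))ᵀ =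
      (12 : QuadraticAlgebra ℚ 3 0) • (1 : Matrix (Fin 2) (Fin 2) (QuadraticAlgebra ℚ 3 0)) := by
  ext i j <;> fin_cases i <;> fin_cases j <;> simp [Matrix.mul_apply, Fin.sum_univ_six] <;> norm_num

/-- the folding rows `U₀` for the eigenvalue `1`: `U₀ᵀ U₀ = −2·(S₆² − 4)(S₆ + 1)` (explicit right-hand side) -/
lemma fold6one_transpose_mul :
    (!![ω, ω, 0, -ω, -ω, 0; -1, 1, 2, 1, -1, -2] : Matrix (Fin 2) (Fin 6) (QuadraticAlgebra ℚ 3 0))ᵀ *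
      (!![ω, ω, 0, -ω, -ω, 0; -1, 1, 2, 1, -1, -2] : Matrix (Fin 2) (Fin 6) (QuadraticAlgebra ℚ 3 0)) =
      (-2 : QuadraticAlgebra ℚ 3 0) •
        (!![-2, -1, 1, 2, 1, -1; -1, -2, -1, 1, 2, 1; 1, -1, -2, -1, 1, 2; 2, 1, -1, -2, -1, 1; 1, 2, 1, -1, -2, -1;
          -1, 1, 2, 1, -1, -2] : Matrix (Fin 6) (Fin 6) (QuadraticAlgebra ℚ 3 0)) := by
  ext i j <;> fin_cases i <;> fin_cases j <;>
    simp [Matrix.mul_apply, Fin.sum_univ_two] <;> norm_num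

end finite6

end Summit.Ventures.DiscreteObjects.Hadamard
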